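import Literature.Probability.RandomPlanarGeometry.HexSAWSurfaceWallRenewalBlocksNineA2
import Literature.Probability.RandomPlanarGeometry.HexSAWSurfaceWallRenewalCensusEightA
import HarnessLib

/-!
# The order-NINE diagonal census, part A: `N₁₀,₁ = 267` exactly (kernel); `Λ₂₀(y) = 267y + 99y² + 7y³`; `#(ipwb 20) = 373`

Topic `Literature/Probability/RandomPlanarGeometry` (lane «pcv-sawmu», a-p6 g20, car «CENSUS-NINE-A»; parents: «BLOCKS-NINE-A1/A2» (`TwentyOne.W : Fin 267 → _`,
the exhibited one-visit irreducible positive wall bridges of length twenty), «CENSUS-EIGHT-A» (`IPWB_twenty_eq_ninetyNine : Λ₂₀ = N₁₀,₁y + 99y² + 7y³`),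
and a-idea-1 g34's «SEVEN-CENSUS» engine (`WCensus.grow`, `revList_mem_censusW`, `eq_of_revList_eq`, `frozen_of_mem_ipwb`)).

The diagonal `s − v = 8` of the wall-renewal census is complete in the tree (`a₇ = 18`, «A7-EXACT»; `m₈ = 513`, «EIGHTH-EXACT-MEAN»).  The next diagonal
`s − v = 9` has the four classes `(10,1), (11,2), (12,3), (13,4)` (data `267 / 295 / 132 / 16`).  This module certifies the FIRST of them by a single kernel
certificate over car 72's pruned search (`6123` search nodes):

* §1 `TwentyOne.revLists`, ★★ `TwentyOne.censusW_subset : ∀ l ∈ WCensus.censusW 20 1, l ∈ revLists` (`decide +kernel`, one budget line);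
* §2 ★★ `exists_eq_twentyOne_W_of_mem_ipwb_twenty_of_visits_eq_one`, `oneVisit_ipwb_twenty_eq_image`, ★★★ `card_oneVisit_ipwb_twenty_eq_twoSixtySeven`
  (**`N₁₀,₁ = 267`**), `card_ipwb_twenty_eq_threeSeventyThree` (**`#(ipwb 20) = 373 = 267 + 99 + 7`**);
* §3 ★★★ `IPWB_twenty_eq_twoSixtySeven : Λ₂₀(y) = 267y + 99y² + 7y³`, `pwbLaw_ten_eq_exact : f₁₀ = (267y + 99y² + 7y³)/β²⁰` — **the renewal law is explicit
  through half-length TEN**.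

NOT claimed: the other three diagonal-9 classes; anything about `β` (the order-nine coefficient needs all four).  Label (lane): LANE CENSUS (kernel certificate) ⊕
LANE LEMMAS, DERIVED/computed; budget lines: 1 (`set_option maxHeartbeats 4000000 in`).  Sources: [MadrasSlade1993, Section 4.2, Definition 4.2.1, (4.2.2), (4.2.4),
Theorem 4.2.2 (pp. 91–92)], [Kesten1963SAW, Section 4], [EntingJensen2009, Section 7.4.2, Fig. 7.10].
-/

namespace Literature.Probability.RandomPlanarGeometry.SAW.HexBW.Wall

open Finset Function Census
open Literature.Probability.LatticeModels

/-! ### §1  The kernel certificate -/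

namespace TwentyOne

/-- The 267 tables as reversed site lists. [cite: EntingJensen2009, Section 7.4.2, Fig. 7.10] -/
def revLists : List (List (ℤ × ℤ)) := (List.finRange 267).map fun i => revList (W i) 20

set_option maxHeartbeats 4000000 in
/-- **Kernel certificate** (`6123` search nodes): every list of the `(20, 1)` census is one of the 267 tables. [cite: MadrasSlade1993, Section 4.2, Definition 4.2.1, (4.2.2)] -/
theorem censusW_subset : ∀ l ∈ WCensus.censusW 20 1, l ∈ revLists := by decide +kernel

end TwentyOne

/-! ### §2  Exhaustion and the class number `N₁₀,₁ = 267` -/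

variable {y : ℝ}

/-- ★★ **A one-visit irreducible positive wall bridge of length twenty is one of the 267 exhibited blocks** (symbolic length).
[cite: MadrasSlade1993, Section 4.2, Definition 4.2.1, (4.2.2)] [cite: Kesten1963SAW, Section 4] [cite: EntingJensen2009, Section 7.4.2, Fig. 7.10] -/
theorem exists_eq_twentyOne_W_of_mem_ipwb_twenty_of_visits_eq_one {m : ℕ} {ω : ℕ → Site 2} (hm : m = 20) (hω : ω ∈ ipwb m)
    (hv : visits m ω = 1) : ∃ i : Fin 267, ω = TwentyOne.W i := by
  have h1 := WCensus.revList_mem_censusW hω hv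
  rw [hm] at h1
  obtain ⟨i, -, hi⟩ := List.mem_map.1 (TwentyOne.censusW_subset _ h1)
  refine ⟨i, ?_⟩
  have hfr := WCensus.frozen_of_mem_ipwb hω
  have hfr' := WCensus.frozen_of_mem_ipwb (TwentyOne.W_mem_ipwb hm i)
  rw [hm] at hfr hfr'
  exact WCensus.eq_of_revList_eq hfr hfr' hi.symm

open Classical in
/-- ★★ The one-visit class of `ipwb 20` is the image of the 267 tables (symbolic length). [cite: MadrasSlade1993, Section 4.2, Definition 4.2.1, (4.2.2)] [cite: EntingJensen2009, Section 7.4.2, Fig. 7.10] -/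
theorem oneVisit_ipwb_twenty_eq_image {m : ℕ} (hm : m = 20) :
    ((ipwb m).filter fun ω => visits m ω = 1) = Finset.univ.image TwentyOne.W := by
  ext ω
  rw [Finset.mem_filter]
  constructor
  · rintro ⟨hω, hv⟩
    obtain ⟨i, rfl⟩ := exists_eq_twentyOne_W_of_mem_ipwb_twenty_of_visits_eq_one hm hω hv
    exact Finset.mem_image_of_mem _ (Finset.mem_univ i)
  · intro h
    obtain ⟨i, -, rfl⟩ := Finset.mem_image.1 h
    exact ⟨TwentyOne.W_mem_ipwb hm i, by rw [hm]; exact TwentyOne.visits_W i⟩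

open Classical in
/-- ★★★ **`N₁₀,₁ = 267`**: there are exactly two hundred and sixty-seven one-visit irreducible positive wall bridges of length twenty (symbolic length).
[cite: MadrasSlade1993, Section 4.2, Definition 4.2.1, (4.2.2) and Theorem 4.2.2 (pp. 91–92)] [cite: Kesten1963SAW, Section 4] -/
theorem card_oneVisit_ipwb_twenty_eq_twoSixtySeven {m : ℕ} (hm : m = 20) : #((ipwb m).filter fun ω => visits m ω = 1) = 267 := by
  rw [oneVisit_ipwb_twenty_eq_image hm, Finset.card_image_of_injective _ TwentyOne.W_injective]
  simp

open Classical in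
/-- ★★ **`#(ipwb 20) = 373`** (`267 + 99 + 7`: every block of length twenty has one, two or three visits; symbolic length).
[cite: MadrasSlade1993, Section 4.2, Definition 4.2.1, (4.2.2)] [cite: Kesten1963SAW, Section 4] -/
theorem card_ipwb_twenty_eq_threeSeventyThree {m : ℕ} (hm : m = 20) : #(ipwb m) = 373 := by
  have h := Finset.card_filter_add_card_filter_not (s := ipwb m) (fun ω => visits m ω = 1)
  have h' := Finset.card_filter_add_card_filter_not (s := (ipwb m).filter fun ω => ¬ visits m ω = 1) (fun ω => visits m ω = 2)
  have h2 : (((ipwb m).filter fun ω => ¬ visits m ω = 1).filter fun ω => visits m ω = 2) = (ipwb m).filter fun ω => visits m ω = 2 := by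
    rw [Finset.filter_filter]
    refine Finset.filter_congr fun ω _ => ?_
    omega
  have h3 : (((ipwb m).filter fun ω => ¬ visits m ω = 1).filter fun ω => ¬ visits m ω = 2) = (ipwb m).filter fun ω => visits m ω = 3 := by
    rw [Finset.filter_filter]
    refine Finset.filter_congr fun ω hω => ?_
    have h1 := one_le_visits_of_mem_ipwb hω
    have h4 := visits_le_three_of_mem_ipwb_twenty hm hω
    omega
  rw [h2, h3, card_twoVisit_ipwb_twenty_eq_ninetyNine hm, card_threeVisit_ipwb_twenty_eq_seven hm] at h'
  rw [card_oneVisit_ipwb_twenty_eq_twoSixtySeven hm] at h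
  omega

/-! ### §3  The renewal law is explicit through half-length ten -/

/-- ★★★ **`Λ₂₀(y) = 267y + 99y² + 7y³`** (symbolic length). [cite: MadrasSlade1993, Section 4.2, (4.2.2) (p. 91)] [cite: Kesten1963SAW, Section 4] -/
theorem IPWB_twenty_eq_twoSixtySeven {m : ℕ} (hm : m = 20) (y : ℝ) : IPWB m y = 267 * y + 99 * y ^ 2 + 7 * y ^ 3 := by
  classical
  rw [IPWB_twenty_eq_ninetyNine hm, card_oneVisit_ipwb_twenty_eq_twoSixtySeven hm]
  norm_num

/-- ★★ **`f₁₀(y) = (267y + 99y² + 7y³)/β(y)²⁰`** — the renewal law is explicit through half-length ten. [cite: MadrasSlade1993, Section 4.2, (4.2.2), (4.2.4) (p. 91)] -/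
theorem pwbLaw_ten_eq_exact (y : ℝ) : pwbLaw y 10 = (267 * y + 99 * y ^ 2 + 7 * y ^ 3) / wallRate y ^ 20 := by
  obtain ⟨m, hm⟩ : ∃ m : ℕ, m = 20 := ⟨_, rfl⟩
  have e : pwbLaw y 10 = IPWB m y / wallRate y ^ m := by rw [pwbLaw, hm]
  rw [e, IPWB_twenty_eq_twoSixtySeven hm, hm]

end Literature.Probability.RandomPlanarGeometry.SAW.HexBW.Wall
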